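import Mathlib.MeasureTheory.Function.L2Space
import Mathlib.MeasureTheory.Integral.MeanInequalities
import Mathlib.Analysis.SpecialFunctions.Pow.Continuity
import Mathlib.Analysis.SpecialFunctions.Sqrt
import HarnessLib

/-!
# Uniform bounds pass to weak limits: `L²` pairings of Hilbert-valued fields, and
`L^{3/2}`-bounds along `L^{5/3}`-weakly convergent sequences

Analysis/FunctionSpaces support file (theorems only, all [folklore]). The function-level form of
the weak lower semicontinuity of `L^p` norms (Brezis 2011, Prop. 3.5 (iii): "if `xₙ ⇀ x` weakly
then `‖x‖ ≤ liminf ‖xₙ‖`"), stated as "a bound obeyed by every term of a weakly convergent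
sequence is obeyed by the limit" and proved bare-handed by testing against the limit itself:

* `sum_lintegral_enorm_sq_le_of_tendsto_integral_inner` — for finitely many sequences of fields
  `f k i : X → E` (`E` a real inner product space) whose pairings against `g i ∈ L²(μ; E)` satisfy
  `∑ᵢ ∫ ⟪f k i, g i⟫ → ∑ᵢ ∫ ⟪g i, g i⟫`, a bound `∑ᵢ ∫⁻ ‖f k i‖ₑ² ≤ B` for all `k` gives
  `∑ᵢ ∫⁻ ‖g i‖ₑ² ≤ B` (`∑ᵢ‖gᵢ‖₂² = lim ∑ᵢ ∫⟪f k i, gᵢ⟫ ≤ (∑ᵢ‖f k i‖₂²)^{1/2} (∑ᵢ‖gᵢ‖₂²)^{1/2}`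
  by Cauchy–Schwarz in `L²` and in `ℝ^ι`); `lintegral_enorm_sq_le_of_tendsto_integral_inner` is
  the case of one sequence. (Used for weak limits of velocity slices in `L²(B₁)` and of the
  columns of velocity gradients in `L²((t₁,t₂) × B₁)`.)
* `lintegral_enorm_rpow_three_halves_le_of_tendsto_integral_mul` — on a finite measure space,
  if real functions `f k` converge to `g ∈ L^{5/3}(μ)` weakly in `L^{5/3}(μ)` (pairings against
  every `ψ ∈ L^{5/2}(μ)` converge) and `∫⁻ |f k|^{3/2} ≤ B` for all `k`, then `∫⁻ |g|^{3/2} ≤ B`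
  (test against `ψ = g |g|^{-1/2} ∈ L^{5/2}`, Hölder with exponents `(3/2, 3)`). (Used for weak
  `L^{5/3}` limits of pressures with uniform `L^{3/2}` bounds.)

## Mathlib search

Mathlib (this pin) has Hölder's inequality for `ℝ≥0∞`-valued functions and finite sums
(`ENNReal.lintegral_mul_le_Lp_mul_Lq`, `ENNReal.inner_le_Lp_mul_Lq`) and
`enorm_integral_le_lintegral_enorm`, but no statement that norm bounds pass to weak limits in
`L^p` (searched `le_liminf`/`WeakSpace`/`tendsto_integral` in `MeasureTheory/Function/LpSpace`,
`L2Space`); the tree's `DiagonalWeakLimits.norm_le_of_tendsto_inner_of_eventually_norm_le` is the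
abstract Hilbert-space form, not the function-level one needed for families and for `L^{3/2}`.

## References

* H. Brezis, *Functional Analysis, Sobolev Spaces and Partial Differential Equations* (Springer
  2011), Prop. 3.5 (iii), Thm. 4.10 [Brezis2011].
-/

noncomputable section

open MeasureTheory Filter Set Function
open scoped ENNReal NNReal Topology RealInnerProductSpace

namespace Literature.Analysis.FunctionSpaces

variable {X : Type*} [MeasurableSpace X] {μ : Measure X}

/-! ## `L²` pairings of Hilbert-valued fields -/

section Hilbert

variable {E : Type*} [NormedAddCommGroup E] [InnerProductSpace ℝ E]

/-- `∫ ⟪g, g⟫ dμ = (∫⁻ ‖g‖ₑ² dμ).toReal` for an a.e.-strongly measurable field. [folklore] -/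
theorem integral_inner_self_eq_toReal_lintegral {g : X → E} (hg : AEStronglyMeasurable g μ) :
    ∫ x, ⟪g x, g x⟫ ∂μ = (∫⁻ x, ‖g x‖ₑ ^ 2 ∂μ).toReal := by
  simp_rw [real_inner_self_eq_norm_sq]
  rw [integral_eq_lintegral_of_nonneg_ae (Eventually.of_forall fun x => sq_nonneg _)
    (hg.norm.aemeasurable.pow_const 2).aestronglyMeasurable]
  congr 1
  refine lintegral_congr fun x => ?_
  rw [← ofReal_norm, ENNReal.ofReal_pow (norm_nonneg _)]

/-- **Cauchy–Schwarz for the `L²` pairing**, `ℝ≥0∞` form without finiteness assumptions: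
`‖∫ ⟪f, g⟫‖ₑ ≤ (∫⁻ ‖f‖ₑ²)^{1/2} (∫⁻ ‖g‖ₑ²)^{1/2}`. [folklore] -/
theorem enorm_integral_inner_le_lintegral {f g : X → E} (hf : AEStronglyMeasurable f μ)
    (hg : AEStronglyMeasurable g μ) :
    ‖∫ x, ⟪f x, g x⟫ ∂μ‖ₑ ≤
      (∫⁻ x, ‖f x‖ₑ ^ 2 ∂μ) ^ (1 / 2 : ℝ) * (∫⁻ x, ‖g x‖ₑ ^ 2 ∂μ) ^ (1 / 2 : ℝ) := by
  refine (enorm_integral_le_lintegral_enorm _).trans ?_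
  have h1 : ∫⁻ x, ‖⟪f x, g x⟫‖ₑ ∂μ ≤ ∫⁻ x, ((fun x => ‖f x‖ₑ) * fun x => ‖g x‖ₑ) x ∂μ := by
    refine lintegral_mono fun x => ?_
    rw [Pi.mul_apply, ← ofReal_norm, ← ofReal_norm, ← ofReal_norm,
      ← ENNReal.ofReal_mul (norm_nonneg _)]
    exact ENNReal.ofReal_le_ofReal (norm_inner_le_norm _ _)
  refine h1.trans ?_
  have h2 := ENNReal.lintegral_mul_le_Lp_mul_Lq μ Real.HolderConjugate.two_two hf.enorm hg.enorm
  simpa only [ENNReal.rpow_two] using h2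

omit [InnerProductSpace ℝ E] in
/-- `‖g‖²_{L²} < ∞` for `g ∈ L²`, in the `∫⁻ ‖g‖ₑ²` form. [folklore] -/
theorem lintegral_enorm_sq_ne_top_of_memLp {g : X → E} (hg : MemLp g 2 μ) :
    ∫⁻ x, ‖g x‖ₑ ^ 2 ∂μ ≠ ⊤ := by
  have h := (eLpNorm_lt_top_iff_lintegral_rpow_enorm_lt_top two_ne_zero ENNReal.ofNat_ne_top).1
    hg.eLpNorm_lt_top
  simp only [ENNReal.toReal_ofNat, ENNReal.rpow_two] at h
  exact h.ne

/-- **A uniform `L²` bound on finitely many weakly convergent sequences passes to the limits.**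
Let `E` be a real inner product space, `ι` finite, `g i ∈ L²(μ; E)` and `f k i : X → E`
a.e.-strongly measurable with `∑ᵢ ∫ ⟪f k i, g i⟫ dμ → ∑ᵢ ∫ ⟪g i, g i⟫ dμ` as `k → ∞` (which holds
when `f k i ⇀ g i` weakly in `L²(μ; E)` for each `i`). If `∑ᵢ ∫⁻ ‖f k i‖ₑ² ≤ B` for every `k`, then
`∑ᵢ ∫⁻ ‖g i‖ₑ² ≤ B` (Brezis 2011, Prop. 3.5 (iii) for the Hilbert space `⊕ᵢ L²(μ; E)`; proof:
`∑ᵢ ‖gᵢ‖² = lim ∑ᵢ ∫⟪f k i, gᵢ⟫ ≤ B^{1/2} (∑ᵢ ‖gᵢ‖²)^{1/2}`). [folklore] -/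
theorem sum_lintegral_enorm_sq_le_of_tendsto_integral_inner {ι : Type*} [Fintype ι]
    {f : ℕ → ι → X → E} {g : ι → X → E} {B : ℝ≥0∞}
    (hf : ∀ k i, AEStronglyMeasurable (f k i) μ) (hg : ∀ i, MemLp (g i) 2 μ)
    (hlim : Tendsto (fun k => ∑ i, ∫ x, ⟪f k i x, g i x⟫ ∂μ) atTop
      (𝓝 (∑ i, ∫ x, ⟪g i x, g i x⟫ ∂μ)))
    (hB : ∀ k, ∑ i, ∫⁻ x, ‖f k i x‖ₑ ^ 2 ∂μ ≤ B) :
    ∑ i, ∫⁻ x, ‖g i x‖ₑ ^ 2 ∂μ ≤ B := by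
  rcases eq_or_ne B ⊤ with rfl | hBtop
  · exact le_top
  set a : ι → ℝ≥0∞ := fun i => ∫⁻ x, ‖g i x‖ₑ ^ 2 ∂μ with ha
  set b : ℕ → ι → ℝ≥0∞ := fun k i => ∫⁻ x, ‖f k i x‖ₑ ^ 2 ∂μ with hb
  have hatop : ∀ i, a i ≠ ⊤ := fun i => lintegral_enorm_sq_ne_top_of_memLp (hg i)
  have hbtop : ∀ k i, b k i ≠ ⊤ := fun k i =>
    ne_top_of_le_ne_top hBtop
      ((Finset.single_le_sum (f := fun j => b k j) (fun _ _ => zero_le) (Finset.mem_univ i)).trans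
        (hB k))
  set A : ℝ≥0∞ := ∑ i, a i with hA
  have hAtop : A ≠ ⊤ := ENNReal.sum_ne_top.2 fun i _ => hatop i
  change A ≤ B
  -- the limit of the pairings is `A.toReal`
  have hlimA : Tendsto (fun k => ∑ i, ∫ x, ⟪f k i x, g i x⟫ ∂μ) atTop (𝓝 A.toReal) := by
    have e : ∑ i, ∫ x, ⟪g i x, g i x⟫ ∂μ = A.toReal := by
      rw [hA, ENNReal.toReal_sum fun i _ => hatop i]
      exact Finset.sum_congr rfl fun i _ => integral_inner_self_eq_toReal_lintegral (hg i).1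
    rwa [e] at hlim
  -- each pairing sum is at most `(B^{1/2} A^{1/2}).toReal`
  set M : ℝ≥0∞ := B ^ (1 / 2 : ℝ) * A ^ (1 / 2 : ℝ) with hM
  have hMtop : M ≠ ⊤ := ENNReal.mul_ne_top (ENNReal.rpow_ne_top_of_nonneg (by norm_num) hBtop)
    (ENNReal.rpow_ne_top_of_nonneg (by norm_num) hAtop)
  have hsq : ∀ x : ℝ≥0∞, (x ^ (1 / 2 : ℝ)) ^ (2 : ℝ) = x := fun x => by
    rw [← ENNReal.rpow_mul]; norm_num
  have hbound : ∀ k, ∑ i, ∫ x, ⟪f k i x, g i x⟫ ∂μ ≤ M.toReal := by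
    intro k
    have h1 : ∀ i, ∫ x, ⟪f k i x, g i x⟫ ∂μ ≤ (b k i ^ (1 / 2 : ℝ) * a i ^ (1 / 2 : ℝ)).toReal := by
      intro i
      have hfin : b k i ^ (1 / 2 : ℝ) * a i ^ (1 / 2 : ℝ) ≠ ⊤ :=
        ENNReal.mul_ne_top (ENNReal.rpow_ne_top_of_nonneg (by norm_num) (hbtop k i))
          (ENNReal.rpow_ne_top_of_nonneg (by norm_num) (hatop i))
      have h := enorm_integral_inner_le_lintegral (μ := μ) (hf k i) (hg i).1
      have habs : |∫ x, ⟪f k i x, g i x⟫ ∂μ| ≤ (b k i ^ (1 / 2 : ℝ) * a i ^ (1 / 2 : ℝ)).toReal := by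
        rw [← ENNReal.ofReal_le_iff_le_toReal hfin, ← Real.enorm_eq_ofReal_abs]
        exact h
      exact (le_abs_self _).trans habs
    have hcs : ∑ i, b k i ^ (1 / 2 : ℝ) * a i ^ (1 / 2 : ℝ) ≤ M := by
      calc ∑ i, b k i ^ (1 / 2 : ℝ) * a i ^ (1 / 2 : ℝ)
          ≤ (∑ i, (b k i ^ (1 / 2 : ℝ)) ^ (2 : ℝ)) ^ (1 / 2 : ℝ) *
              (∑ i, (a i ^ (1 / 2 : ℝ)) ^ (2 : ℝ)) ^ (1 / 2 : ℝ) :=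
            ENNReal.inner_le_Lp_mul_Lq Finset.univ _ _ Real.HolderConjugate.two_two
        _ = (∑ i, b k i) ^ (1 / 2 : ℝ) * A ^ (1 / 2 : ℝ) := by simp_rw [hsq]; rfl
        _ ≤ M := by rw [hM]; gcongr; exact hB k
    calc ∑ i, ∫ x, ⟪f k i x, g i x⟫ ∂μ
        ≤ ∑ i, (b k i ^ (1 / 2 : ℝ) * a i ^ (1 / 2 : ℝ)).toReal := Finset.sum_le_sum fun i _ => h1 i
      _ = (∑ i, b k i ^ (1 / 2 : ℝ) * a i ^ (1 / 2 : ℝ)).toReal :=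
          (ENNReal.toReal_sum fun i _ => ENNReal.mul_ne_top
            (ENNReal.rpow_ne_top_of_nonneg (by norm_num) (hbtop k i))
            (ENNReal.rpow_ne_top_of_nonneg (by norm_num) (hatop i))).symm
      _ ≤ M.toReal := ENNReal.toReal_mono hMtop hcs
  -- pass to the limit and cancel `A^{1/2}`
  have hAM : A ≤ M := (ENNReal.toReal_le_toReal hAtop hMtop).1 (le_of_tendsto' hlimA hbound)
  rcases eq_or_ne A 0 with hA0 | hA0
  · rw [hA0]; exact zero_le
  have hhalf : A ^ (1 / 2 : ℝ) ≤ B ^ (1 / 2 : ℝ) := by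
    by_contra hlt
    have hne0 : A ^ (1 / 2 : ℝ) ≠ 0 := by
      rw [Ne, ENNReal.rpow_eq_zero_iff]; push Not
      exact ⟨fun h => absurd h hA0, fun h => absurd h hAtop⟩
    have hnet : A ^ (1 / 2 : ℝ) ≠ ⊤ := ENNReal.rpow_ne_top_of_nonneg (by norm_num) hAtop
    have hlt' : M < A := by
      calc M = B ^ (1 / 2 : ℝ) * A ^ (1 / 2 : ℝ) := rfl
        _ < A ^ (1 / 2 : ℝ) * A ^ (1 / 2 : ℝ) := ENNReal.mul_lt_mul_left hne0 hnet (not_le.1 hlt)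
        _ = A := by rw [← ENNReal.rpow_add_of_nonneg _ _ (by norm_num) (by norm_num)]; norm_num
    exact absurd hAM (not_le.2 hlt')
  exact (ENNReal.rpow_le_rpow_iff (by norm_num : (0 : ℝ) < 1 / 2)).1 hhalf

/-- **A uniform `L²` bound on a weakly convergent sequence passes to the limit**: if
`∫ ⟪f k, g⟫ dμ → ∫ ⟪g, g⟫ dμ` with `g ∈ L²(μ; E)` (e.g. `f k ⇀ g` weakly in `L²(μ; E)`) and
`∫⁻ ‖f k‖ₑ² ≤ B` for all `k`, then `∫⁻ ‖g‖ₑ² ≤ B` (Brezis 2011, Prop. 3.5 (iii) in `L²(μ; E)`: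
`‖g‖² = lim ∫⟪f k, g⟫ ≤ B^{1/2} ‖g‖`). [folklore] -/
theorem lintegral_enorm_sq_le_of_tendsto_integral_inner {f : ℕ → X → E} {g : X → E} {B : ℝ≥0∞}
    (hf : ∀ k, AEStronglyMeasurable (f k) μ) (hg : MemLp g 2 μ)
    (hlim : Tendsto (fun k => ∫ x, ⟪f k x, g x⟫ ∂μ) atTop (𝓝 (∫ x, ⟪g x, g x⟫ ∂μ)))
    (hB : ∀ k, ∫⁻ x, ‖f k x‖ₑ ^ 2 ∂μ ≤ B) :
    ∫⁻ x, ‖g x‖ₑ ^ 2 ∂μ ≤ B := by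
  have h := sum_lintegral_enorm_sq_le_of_tendsto_integral_inner (ι := Unit) (μ := μ)
    (f := fun k _ => f k) (g := fun _ => g) (B := B) (fun k _ => hf k) (fun _ => hg)
    (by simpa using hlim) (by simpa using hB)
  simpa using h

end Hilbert

/-! ## `L^{3/2}` bounds along `L^{5/3}`-weakly convergent sequences -/

section ThreeHalves

/-- The test function `ψ = g |g|^{-1/2}` (as `g / √|g|`): `g ψ = |g| √|g|`. [folklore] -/
theorem mul_div_sqrt_abs_self (r : ℝ) : r * (r / Real.sqrt (|r|)) = |r| * Real.sqrt (|r|) := by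
  rw [mul_div_assoc', ← abs_mul_abs_self r, mul_div_assoc, Real.div_sqrt]

/-- `|g / √|g|| = √|g|`. [folklore] -/
theorem abs_div_sqrt_abs_self (r : ℝ) : |r / Real.sqrt (|r|)| = Real.sqrt (|r|) := by
  rw [abs_div, abs_of_nonneg (Real.sqrt_nonneg _), Real.div_sqrt]

/-- `‖g / √|g|‖ₑ = ‖g‖ₑ^{1/2}`. [folklore] -/
theorem enorm_div_sqrt_abs_self (r : ℝ) : ‖r / Real.sqrt (|r|)‖ₑ = ‖r‖ₑ ^ (1 / 2 : ℝ) := by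
  rw [Real.enorm_eq_ofReal_abs, abs_div_sqrt_abs_self, Real.sqrt_eq_rpow,
    ← ENNReal.ofReal_rpow_of_nonneg (abs_nonneg _) (by norm_num), ← Real.enorm_eq_ofReal_abs]

/-- `ofReal (|g| √|g|) = ‖g‖ₑ^{3/2}`. [folklore] -/
theorem ofReal_abs_mul_sqrt_abs (r : ℝ) :
    ENNReal.ofReal (|r| * Real.sqrt (|r|)) = ‖r‖ₑ ^ (3 / 2 : ℝ) := by
  rw [ENNReal.ofReal_mul (abs_nonneg _), Real.sqrt_eq_rpow,
    ← ENNReal.ofReal_rpow_of_nonneg (abs_nonneg _) (by norm_num), ← Real.enorm_eq_ofReal_abs,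
    show (3 / 2 : ℝ) = 1 + 1 / 2 by norm_num, ENNReal.rpow_add_of_nonneg _ _ (by norm_num)
      (by norm_num), ENNReal.rpow_one]

/-- On `[0, ∞]`: `t^a ≤ 1 + t^b` for `0 ≤ a ≤ b`. [folklore] -/
theorem _root_.ENNReal.rpow_le_one_add_rpow_of_le (t : ℝ≥0∞) {a b : ℝ} (ha : 0 ≤ a) (hab : a ≤ b) :
    t ^ a ≤ 1 + t ^ b := by
  rcases le_or_gt t 1 with ht | ht
  · exact (ENNReal.rpow_le_one ht ha).trans le_self_add
  · exact (ENNReal.rpow_le_rpow_of_exponent_le ht.le hab).trans le_add_self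

/-- **A uniform `L^{3/2}` bound passes to weak `L^{5/3}` limits** (finite measure space). Let
`g ∈ L^{5/3}(μ)` and let `f k : X → ℝ` be a.e.-strongly measurable with
`∫ f k ψ dμ → ∫ g ψ dμ` for every `ψ ∈ L^{5/2}(μ)` (weak convergence in `L^{5/3}(μ)`, `5/2` the
dual exponent). If `∫⁻ |f k|^{3/2} ≤ B` for all `k`, then `∫⁻ |g|^{3/2} ≤ B` (Brezis 2011,
Prop. 3.5 (iii); proof: `ψ = g|g|^{-1/2} ∈ L³(μ) ⊂ L^{5/2}(μ)`, and by Hölder with exponents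
`(3/2, 3)`, `∫|g|^{3/2} = lim ∫ f k ψ ≤ B^{2/3} (∫|g|^{3/2})^{1/3}`). [folklore] -/
theorem lintegral_enorm_rpow_three_halves_le_of_tendsto_integral_mul [IsFiniteMeasure μ]
    {f : ℕ → X → ℝ} {g : X → ℝ} {B : ℝ≥0∞}
    (hf : ∀ k, AEStronglyMeasurable (f k) μ) (hg : MemLp g (5 / 3 : ℝ≥0∞) μ)
    (hlim : ∀ ψ : X → ℝ, MemLp ψ (5 / 2 : ℝ≥0∞) μ →
      Tendsto (fun k => ∫ x, f k x * ψ x ∂μ) atTop (𝓝 (∫ x, g x * ψ x ∂μ)))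
    (hB : ∀ k, ∫⁻ x, ‖f k x‖ₑ ^ (3 / 2 : ℝ) ∂μ ≤ B) :
    ∫⁻ x, ‖g x‖ₑ ^ (3 / 2 : ℝ) ∂μ ≤ B := by
  rcases eq_or_ne B ⊤ with rfl | hBtop
  · exact le_top
  -- `g ∈ L^{5/3}`: the basic finiteness
  have hg53 : ∫⁻ x, ‖g x‖ₑ ^ (5 / 3 : ℝ) ∂μ < ⊤ := by
    have h := (eLpNorm_lt_top_iff_lintegral_rpow_enorm_lt_top (p := (5 / 3 : ℝ≥0∞))
      (by norm_num) (ENNReal.div_ne_top (by norm_num) (by norm_num))).1 hg.eLpNorm_lt_top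
    have e : (5 / 3 : ℝ≥0∞).toReal = 5 / 3 := by
      rw [ENNReal.toReal_div]; norm_num
    rwa [e] at h
  have hgm : AEStronglyMeasurable g μ := hg.1
  -- the test function `ψ = g / √|g|`
  set ψ : X → ℝ := fun x => g x / Real.sqrt (|g x|) with hψ
  have hψm : AEStronglyMeasurable ψ μ := by
    have h1 : AEMeasurable g μ := hgm.aemeasurable
    have h2 : AEMeasurable (fun x => Real.sqrt (|g x|)) μ :=
      Real.continuous_sqrt.measurable.comp_aemeasurable
        (continuous_abs.measurable.comp_aemeasurable h1)
    exact (h1.div h2).aestronglyMeasurable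
  have hψe : ∀ x, ‖ψ x‖ₑ = ‖g x‖ₑ ^ (1 / 2 : ℝ) := fun x => enorm_div_sqrt_abs_self (g x)
  have hψ52 : MemLp ψ (5 / 2 : ℝ≥0∞) μ := by
    refine ⟨hψm, (eLpNorm_lt_top_iff_lintegral_rpow_enorm_lt_top (p := (5 / 2 : ℝ≥0∞))
      (by norm_num) (ENNReal.div_ne_top (by norm_num) (by norm_num))).2 ?_⟩
    have e : (5 / 2 : ℝ≥0∞).toReal = 5 / 2 := by
      rw [ENNReal.toReal_div]; norm_num
    rw [e]
    calc ∫⁻ x, ‖ψ x‖ₑ ^ (5 / 2 : ℝ) ∂μ = ∫⁻ x, ‖g x‖ₑ ^ (5 / 4 : ℝ) ∂μ := by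
          refine lintegral_congr fun x => ?_
          rw [hψe, ← ENNReal.rpow_mul]; norm_num
      _ ≤ ∫⁻ x, (1 + ‖g x‖ₑ ^ (5 / 3 : ℝ)) ∂μ :=
          lintegral_mono fun x => ENNReal.rpow_le_one_add_rpow_of_le _ (by norm_num) (by norm_num)
      _ = μ univ + ∫⁻ x, ‖g x‖ₑ ^ (5 / 3 : ℝ) ∂μ := by
          rw [lintegral_add_left measurable_const, lintegral_const, one_mul]
      _ < ⊤ := ENNReal.add_lt_top.2 ⟨measure_lt_top _ _, hg53⟩
  -- `A = ∫⁻ |g|^{3/2} < ∞`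
  set A : ℝ≥0∞ := ∫⁻ x, ‖g x‖ₑ ^ (3 / 2 : ℝ) ∂μ with hA
  have hAtop : A ≠ ⊤ := by
    refine ne_top_of_le_ne_top (ENNReal.add_lt_top.2 ⟨measure_lt_top μ univ, hg53⟩).ne ?_
    calc A ≤ ∫⁻ x, (1 + ‖g x‖ₑ ^ (5 / 3 : ℝ)) ∂μ :=
          lintegral_mono fun x => ENNReal.rpow_le_one_add_rpow_of_le _ (by norm_num) (by norm_num)
      _ = μ univ + ∫⁻ x, ‖g x‖ₑ ^ (5 / 3 : ℝ) ∂μ := by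
          rw [lintegral_add_left measurable_const, lintegral_const, one_mul]
  -- the pairing with the limit is `A.toReal`
  have hgψ : ∫ x, g x * ψ x ∂μ = A.toReal := by
    have e1 : (fun x => g x * ψ x) = fun x => |g x| * Real.sqrt (|g x|) := by
      funext x; exact mul_div_sqrt_abs_self (g x)
    have habs : AEMeasurable (fun x => |g x|) μ :=
      continuous_abs.measurable.comp_aemeasurable hgm.aemeasurable
    have hm : AEStronglyMeasurable (fun x => |g x| * Real.sqrt (|g x|)) μ :=
      (habs.mul (Real.continuous_sqrt.measurable.comp_aemeasurable habs)).aestronglyMeasurable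
    rw [e1, integral_eq_lintegral_of_nonneg_ae (Eventually.of_forall fun x =>
      mul_nonneg (abs_nonneg _) (Real.sqrt_nonneg _)) hm]
    congr 1
    exact lintegral_congr fun x => ofReal_abs_mul_sqrt_abs (g x)
  -- Hölder `(3/2, 3)`: each pairing is at most `(B^{2/3} A^{1/3}).toReal`
  have hpq : (3 / 2 : ℝ).HolderConjugate 3 := Real.holderConjugate_iff.2 ⟨by norm_num, by norm_num⟩
  set M : ℝ≥0∞ := B ^ (2 / 3 : ℝ) * A ^ (1 / 3 : ℝ) with hM
  have hMtop : M ≠ ⊤ := ENNReal.mul_ne_top (ENNReal.rpow_ne_top_of_nonneg (by norm_num) hBtop)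
    (ENNReal.rpow_ne_top_of_nonneg (by norm_num) hAtop)
  have hbound : ∀ k, ∫ x, f k x * ψ x ∂μ ≤ M.toReal := by
    intro k
    have h1 : ‖∫ x, f k x * ψ x ∂μ‖ₑ ≤ M := by
      refine (enorm_integral_le_lintegral_enorm _).trans ?_
      have h2 : ∫⁻ x, ‖f k x * ψ x‖ₑ ∂μ = ∫⁻ x, ((fun x => ‖f k x‖ₑ) * fun x => ‖ψ x‖ₑ) x ∂μ :=
        lintegral_congr fun x => by rw [Pi.mul_apply, enorm_mul]
      rw [h2]
      refine (ENNReal.lintegral_mul_le_Lp_mul_Lq μ hpq (hf k).enorm hψm.enorm).trans ?_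
      have e3 : ∫⁻ x, ‖ψ x‖ₑ ^ (3 : ℝ) ∂μ = A := by
        refine lintegral_congr fun x => ?_
        rw [hψe, ← ENNReal.rpow_mul]; norm_num
      rw [e3, show (1 / (3 / 2) : ℝ) = 2 / 3 by norm_num]
      rw [hM]; gcongr; exact hB k
    have h3 : |∫ x, f k x * ψ x ∂μ| ≤ M.toReal := by
      rw [← ENNReal.ofReal_le_iff_le_toReal hMtop, ← Real.enorm_eq_ofReal_abs]
      exact h1
    exact (le_abs_self _).trans h3
  -- pass to the limit and cancel `A^{1/3}`
  have hAM : A ≤ M := by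
    have h := le_of_tendsto' (hlim ψ hψ52) hbound
    rw [hgψ] at h
    exact (ENNReal.toReal_le_toReal hAtop hMtop).1 h
  rcases eq_or_ne A 0 with hA0 | hA0
  · rw [hA0]; exact zero_le
  have h23 : A ^ (2 / 3 : ℝ) ≤ B ^ (2 / 3 : ℝ) := by
    by_contra hlt
    have hne0 : A ^ (1 / 3 : ℝ) ≠ 0 := by
      rw [Ne, ENNReal.rpow_eq_zero_iff]; push Not
      exact ⟨fun h => absurd h hA0, fun h => absurd h hAtop⟩
    have hnet : A ^ (1 / 3 : ℝ) ≠ ⊤ := ENNReal.rpow_ne_top_of_nonneg (by norm_num) hAtop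
    have hlt' : M < A := by
      calc M = B ^ (2 / 3 : ℝ) * A ^ (1 / 3 : ℝ) := rfl
        _ < A ^ (2 / 3 : ℝ) * A ^ (1 / 3 : ℝ) := ENNReal.mul_lt_mul_left hne0 hnet (not_le.1 hlt)
        _ = A := by rw [← ENNReal.rpow_add_of_nonneg _ _ (by norm_num) (by norm_num)]; norm_num
    exact absurd hAM (not_le.2 hlt')
  exact (ENNReal.rpow_le_rpow_iff (by norm_num : (0 : ℝ) < 2 / 3)).1 h23

end ThreeHalves

end Literature.Analysis.FunctionSpaces

end
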